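import Mathlib
import HarnessLib
import Summits.Ventures.LatticeQCDFlow.Exactness.NCMCGeneralSpaceBennettRootCLT

/-!
# The studentized self-consistent Bennett (BAR) estimate: `ΔF̂ ± z·√((1/Ĝ − 2)/n)` is asymptotically exact

HONEST FRAMING: exact (Metropolis-corrected) sampling algorithms for lattice gauge theory;
figures of merit are autocorrelation/cost numbers at stated couplings and volumes; no
continuum-physics claim.

Venture `LatticeQCDFlow` (cell pub-lqcd), topic `Exactness`; FANOUT row 13 (`eng-snf`, GEN-15).
NEW WORK of the cell (elementary asymptotic statistics: a Lipschitz plug-in, the strong law,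
Slutsky's theorem, one implication of the portmanteau theorem), not a published result; nothing is
cited as a fact (C. H. Bennett 1976; Shirts–Bair–Hooker–Pande 2003 named only).  Fifth file of the
GEN-15 group, on top of `NCMCGeneralSpaceBennettRootCLT.lean`
(`√n (ΔF̂_BAR,n − ΔF) →d N(0, 1/G − 2)`, `G = E_{P_F} σ(ΔF − W)` Bennett's overlap).

## Content

Setting of the group: paired independent evolutions `ω : ℕ → E × E` under
`Measure.infinitePi (fun _ => P_F ⊗ P_R)`, `σ = Real.sigmoid`, a measurable root selection `d̂_n` of
the sample Bennett equation.  The PLUG-IN OVERLAP is the mean Fermi acceptance of the forward works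
at the reported root, `Ĝ_n = (1/n) Σ_{i<n} σ(d̂_n − W(ω i).1)` (at the root it equals the reverse-lane
mean `(1/n) Σ σ(W(ω i).2 − d̂_n)` — that is the equation).

* `abs_sigmoid_sub_sigmoid_le` — `σ` is `¼`-Lipschitz.
* **`tendsto_overlapHat_ae`** — for almost every run (ONE null set), along EVERY real sequence
  `d_n → d⋆` the plug-in `(1/n) Σ_{i<n} σ(d_n − W(ω i).1)` converges to `E_{μF} σ(d⋆ − W)`
  (Lipschitz comparison with the fixed-`d⋆` sample mean + strong law).
* **`CrooksPair.tendsto_overlapHat_ae`** — hence `Ĝ_n → G` a.s. for the BAR root of a Crooks pair.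
* **`CrooksPair.tendstoInDistribution_barRoot_studentized`** — if `G < ½` (the protocol is not
  dissipation-free; `G ≤ ½` always, `overlap_le_half`) then
  `√n (ΔF̂_n − ΔF) / √(1/Ĝ_n − 2) →d N(0, 1)`.
* **`CrooksPair.tendsto_measure_abs_barRoot_sub_le`** — COVERAGE: for every `z ≥ 0` the
  probability that `|ΔF̂_n − ΔF| · √n ≤ z · √(1/Ĝ_n − 2)` — i.e. that
  `ΔF ∈ [ΔF̂_n − z·err_n, ΔF̂_n + z·err_n]` with `err_n = √((1/Ĝ_n − 2)/n)` whenever `err_n > 0` —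
  tends to `gaussianReal 0 1 [−z, z] = P(|N(0,1)| ≤ z)`.
  Reading for the engine (`snf.estimators.bar`): over `n` independent forward/reverse pairs the
  honest large-`n` error bar of the BAR estimate is `√((1/Ĝ − 2)/n)` with `Ĝ` the mean Fermi
  acceptance at the reported root — no variance of works, no ESS enters; and by GEN-11's
  `bennett_lower_bound` no fixed-statistic two-sample estimate has a smaller one.

Scope / NOT CLAIMED: paired independent evolutions only; no rate, no finite-`n` coverage; `G = ½`
(then `P_F = P_R`-type degeneracy, limit law `δ_0`) excluded from the studentized statements;
correlated chain starts not covered; no value for any concrete protocol.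
-/

namespace Summit.Ventures.LatticeQCDFlow.Exactness.GeneralNCMC

open MeasureTheory ProbabilityTheory Set Filter Finset
open scoped ENNReal NNReal Topology

variable {E : Type*} [MeasurableSpace E]

omit [MeasurableSpace E] in
/-- **`σ` is `¼`-Lipschitz**: `|σ x − σ y| ≤ ¼ |x − y|` (`σ' = σ(1 − σ) ≤ ¼`). -/
theorem abs_sigmoid_sub_sigmoid_le (x y : ℝ) :
    |Real.sigmoid x - Real.sigmoid y| ≤ 1 / 4 * |x - y| := by
  have key := (convex_univ (𝕜 := ℝ) (E := ℝ)).norm_image_sub_le_of_norm_hasDerivWithin_le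
    (f := Real.sigmoid) (f' := fun x => Real.sigmoid x * (1 - Real.sigmoid x)) (C := 1 / 4)
    (fun t _ => (Real.hasDerivAt_sigmoid t).hasDerivWithinAt) (fun t _ => ?_) (mem_univ y) (mem_univ x)
  · rwa [Real.norm_eq_abs, Real.norm_eq_abs] at key
  · rw [Real.norm_eq_abs, abs_of_nonneg (dsigmoid_mem_Icc t).1]
    exact (dsigmoid_mem_Icc t).2

/-! ## The plug-in overlap along any sequence converging to the root -/

section TwoLaws

variable (μF μR : Measure E) [IsProbabilityMeasure μF] [IsProbabilityMeasure μR]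
variable {W : E → ℝ}

/-- **The plug-in overlap is strongly consistent along every sequence tending to `d⋆`.**  For almost
every paired run (one null set): for EVERY real sequence `d_n → d⋆`,
`(1/n) Σ_{i<n} σ(d_n − W(ω i).1) → E_{μF} σ(d⋆ − W)`. -/
theorem tendsto_overlapHat_ae (hW : Measurable W) (dstar : ℝ) :
    ∀ᵐ ω ∂(Measure.infinitePi fun _ : ℕ => μF.prod μR), ∀ dseq : ℕ → ℝ,
      Tendsto dseq atTop (𝓝 dstar) →
      Tendsto (fun n : ℕ => (∑ i ∈ range n, Real.sigmoid (dseq n - W (ω i).1)) / n) atTop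
        (𝓝 (∫ a, Real.sigmoid (dstar - W a) ∂μF)) := by
  set μ := μF.prod μR with hμ
  have hm : Measurable fun p : E × E => Real.sigmoid (dstar - W p.1) :=
    _root_.continuous_sigmoid.measurable.comp (measurable_const.sub (hW.comp measurable_fst))
  have hi : Integrable (fun p : E × E => Real.sigmoid (dstar - W p.1)) μ :=
    integrable_sigmoid_comp (measurable_const.sub (hW.comp measurable_fst))
  have hmean : ∫ p, Real.sigmoid (dstar - W p.1) ∂μ = ∫ a, Real.sigmoid (dstar - W a) ∂μF :=
    integral_comp_of_measurePreserving (measurePreserving_fst (μ := μF) (ν := μR))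
      (g := fun a => Real.sigmoid (dstar - W a))
      (_root_.continuous_sigmoid.measurable.comp (measurable_const.sub hW)).aestronglyMeasurable
  filter_upwards [tendsto_sampleMean_ae μ hm hi] with ω hω dseq hdseq
  rw [hmean] at hω
  -- the fixed-`d⋆` sample mean in `range` form
  have hS : Tendsto (fun n : ℕ => (∑ i ∈ range n, Real.sigmoid (dstar - W (ω i).1)) / n) atTop
      (𝓝 (∫ a, Real.sigmoid (dstar - W a) ∂μF)) := by
    refine hω.congr fun n => ?_
    unfold sampleMean
    rw [Fin.sum_univ_eq_sum_range (fun i => Real.sigmoid (dstar - W (ω i).1)) n]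
  -- the plug-in differs from it by at most `¼ |d_n − d⋆|`
  have hdiff : ∀ n : ℕ, |(∑ i ∈ range n, Real.sigmoid (dseq n - W (ω i).1)) / n -
      (∑ i ∈ range n, Real.sigmoid (dstar - W (ω i).1)) / n| ≤ 1 / 4 * |dseq n - dstar| := by
    intro n
    rcases Nat.eq_zero_or_pos n with rfl | hn
    · simp
    · have hn' : (0 : ℝ) < n := by exact_mod_cast hn
      rw [← sub_div, ← sum_sub_distrib, abs_div, abs_of_pos hn', div_le_iff₀ hn']
      calc |∑ i ∈ range n, (Real.sigmoid (dseq n - W (ω i).1) - Real.sigmoid (dstar - W (ω i).1))|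
          ≤ ∑ i ∈ range n, |Real.sigmoid (dseq n - W (ω i).1) - Real.sigmoid (dstar - W (ω i).1)| :=
            abs_sum_le_sum_abs _ _
        _ ≤ ∑ _i ∈ range n, 1 / 4 * |dseq n - dstar| := sum_le_sum fun i _ => by
            have := abs_sigmoid_sub_sigmoid_le (dseq n - W (ω i).1) (dstar - W (ω i).1)
            rwa [show dseq n - W (ω i).1 - (dstar - W (ω i).1) = dseq n - dstar by ring] at this
        _ = 1 / 4 * |dseq n - dstar| * n := by rw [sum_const, card_range, nsmul_eq_mul, mul_comm]
  have hgap : Tendsto (fun n : ℕ => (∑ i ∈ range n, Real.sigmoid (dseq n - W (ω i).1)) / n -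
      (∑ i ∈ range n, Real.sigmoid (dstar - W (ω i).1)) / n) atTop (𝓝 0) := by
    have hb : Tendsto (fun n => 1 / 4 * |dseq n - dstar|) atTop (𝓝 0) := by
      have := ((hdseq.sub_const dstar).abs).const_mul (1 / 4 : ℝ)
      rwa [sub_self, abs_zero, mul_zero] at this
    exact squeeze_zero_norm (fun n => by rw [Real.norm_eq_abs]; exact hdiff n) hb
  have := hgap.add hS
  rw [zero_add] at this
  exact this.congr fun n => by ring

end TwoLaws

/-! ## Crooks pairs: the studentized BAR estimate and its coverage -/

namespace CrooksPair

variable {Ω : Type*} [MeasurableSpace Ω]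
variable {ν₀ ν₁ : Measure Ω} {κF κR : Kernel Ω E} {s e : E → Ω} {W : E → ℝ}
variable {Ω' : Type*} [MeasurableSpace Ω'] {P' : Measure Ω'} [IsProbabilityMeasure P']

/-- **The plug-in overlap converges to Bennett's overlap**: for any root selection `d̂` of the sample
Bennett equation (every `n ≥ 1`), `Ĝ_n = (1/n) Σ_{i<n} σ(d̂_n − W(ω i).1) → G = E_{P_F} σ(ΔF − W)`
almost surely. -/
theorem tendsto_overlapHat_ae [IsFiniteMeasure ν₀] [IsFiniteMeasure ν₁]
    [IsMarkovKernel κF] [IsMarkovKernel κR] (h0 : ν₀ univ ≠ 0) (h1 : ν₁ univ ≠ 0)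
    (h : CrooksPair ν₀ ν₁ κF κR s e W) {ΔF : ℝ}
    (hΔF : Real.exp (-ΔF) = ((ν₀ univ)⁻¹ * ν₁ univ).toReal) {dhat : ℕ → (ℕ → E × E) → ℝ}
    (hdhat : ∀ n, 1 ≤ n → ∀ ω, (∑ i ∈ range n, Real.sigmoid (dhat n ω - W (ω i).1)) -
      ∑ i ∈ range n, Real.sigmoid (W (ω i).2 - dhat n ω) = 0) :
    ∀ᵐ ω ∂(Measure.infinitePi fun _ : ℕ => (fwdPathLaw ν₀ κF).prod (fwdPathLaw ν₁ κR)),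
      Tendsto (fun n : ℕ => (∑ i ∈ range n, Real.sigmoid (dhat n ω - W (ω i).1)) / n) atTop
        (𝓝 (∫ ε, Real.sigmoid (ΔF - W ε) ∂(fwdPathLaw ν₀ κF))) := by
  haveI := isProbabilityMeasure_fwdPathLaw ν₀ h0 κF
  haveI := isProbabilityMeasure_fwdPathLaw ν₁ h1 κR
  filter_upwards [h.tendsto_measurable_barRoot_ae h0 h1 hΔF hdhat,
    GeneralNCMC.tendsto_overlapHat_ae (fwdPathLaw ν₀ κF) (fwdPathLaw ν₁ κR) h.measurable_W ΔF]
    with ω hω hωG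
  exact hωG (fun n => dhat n ω) hω

/-- **Studentized CLT for the self-consistent Bennett estimate.**  For every Crooks pair with
`e^{−ΔF} = Z₁/Z₀` whose overlap satisfies `G < ½`, and every measurable root selection `ΔF̂_n`,
along independent paired evolutions
`√n (ΔF̂_n − ΔF) / √(1/Ĝ_n − 2) →d N(0, 1)`, `Ĝ_n = (1/n) Σ_{i<n} σ(ΔF̂_n − W(ω i).1)`. -/
theorem tendstoInDistribution_barRoot_studentized [IsFiniteMeasure ν₀] [IsFiniteMeasure ν₁]
    [IsMarkovKernel κF] [IsMarkovKernel κR] (h0 : ν₀ univ ≠ 0) (h1 : ν₁ univ ≠ 0)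
    (h : CrooksPair ν₀ ν₁ κF κR s e W) {ΔF : ℝ}
    (hΔF : Real.exp (-ΔF) = ((ν₀ univ)⁻¹ * ν₁ univ).toReal)
    (hG : ∫ ε, Real.sigmoid (ΔF - W ε) ∂(fwdPathLaw ν₀ κF) < 1 / 2)
    {dhat : ℕ → (ℕ → E × E) → ℝ} (hdm : ∀ n, Measurable (dhat n))
    (hdhat : ∀ n, 1 ≤ n → ∀ ω, (∑ i ∈ range n, Real.sigmoid (dhat n ω - W (ω i).1)) -
      ∑ i ∈ range n, Real.sigmoid (W (ω i).2 - dhat n ω) = 0)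
    {Z : Ω' → ℝ} (hZ : HasLaw Z (gaussianReal 0 1) P') :
    haveI := isProbabilityMeasure_fwdPathLaw ν₀ h0 κF
    haveI := isProbabilityMeasure_fwdPathLaw ν₁ h1 κR
    TendstoInDistribution
      (fun (n : ℕ) (ω : ℕ → E × E) => √(n : ℝ) * (dhat n ω - ΔF) /
        √(1 / ((∑ i ∈ range n, Real.sigmoid (dhat n ω - W (ω i).1)) / n) - 2))
      atTop Z (fun _ => Measure.infinitePi fun _ : ℕ => (fwdPathLaw ν₀ κF).prod (fwdPathLaw ν₁ κR))
      P' := by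
  haveI := isProbabilityMeasure_fwdPathLaw ν₀ h0 κF
  haveI := isProbabilityMeasure_fwdPathLaw ν₁ h1 κR
  set P := Measure.infinitePi fun _ : ℕ => (fwdPathLaw ν₀ κF).prod (fwdPathLaw ν₁ κR) with hP
  set G := ∫ ε, Real.sigmoid (ΔF - W ε) ∂(fwdPathLaw ν₀ κF) with hGdef
  have hGpos : 0 < G := h.overlap_pos h0 ΔF
  set v := 1 / G - 2 with hvdef
  have hv : 0 < v := by
    rw [hvdef, sub_pos, lt_div_iff₀ hGpos]
    linarith
  have hsv : √v ≠ 0 := (Real.sqrt_pos.2 hv).ne'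
  -- `Y = √v · Z ~ N(0, v)`: the root CLT applies with this limit variable
  have hY : HasLaw (fun ω' => √v * Z ω') (gaussianReal 0 (1 / G - 2).toNNReal) P' := by
    have h' := gaussianReal_const_mul hZ (√v)
    rw [mul_zero, mul_one] at h'
    convert h' using 3
    apply NNReal.eq
    rw [Real.coe_toNNReal _ hv.le, NNReal.coe_mk, Real.sq_sqrt hv.le]
  have clt := h.tendstoInDistribution_sqrt_mul_barRoot_sub h0 h1 hΔF hdm hdhat hY
  -- the studentizing factor converges in probability to `(√v)⁻¹`
  have hGm : ∀ n : ℕ, Measurable fun ω : ℕ → E × E =>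
      (∑ i ∈ range n, Real.sigmoid (dhat n ω - W (ω i).1)) / n := fun n =>
    (Finset.measurable_sum _ fun i _ => _root_.continuous_sigmoid.measurable.comp
      ((hdm n).sub (h.measurable_W.comp (measurable_fst.comp (measurable_pi_apply i))))).div_const _
  have hUmeas : ∀ n : ℕ, AEMeasurable (fun ω : ℕ → E × E =>
      (√(1 / ((∑ i ∈ range n, Real.sigmoid (dhat n ω - W (ω i).1)) / n) - 2))⁻¹) P :=
    fun n => (((hGm n).const_div 1).sub_const 2).sqrt.inv.aemeasurable
  have hU : TendstoInMeasure P (fun (n : ℕ) (ω : ℕ → E × E) =>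
      (√(1 / ((∑ i ∈ range n, Real.sigmoid (dhat n ω - W (ω i).1)) / n) - 2))⁻¹)
      atTop (fun _ => (√v)⁻¹) := by
    refine tendstoInMeasure_of_tendsto_ae (fun n => (hUmeas n).aestronglyMeasurable) ?_
    filter_upwards [h.tendsto_overlapHat_ae h0 h1 hΔF hdhat] with ω hω
    have hlim : Tendsto (fun n : ℕ =>
        1 / ((∑ i ∈ range n, Real.sigmoid (dhat n ω - W (ω i).1)) / n) - 2) atTop (𝓝 v) :=
      ((tendsto_const_nhds.div hω hGpos.ne')).sub_const 2
    exact (hlim.sqrt).inv₀ hsv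
  have slutsky := clt.continuous_comp_prodMk_of_tendstoInMeasure_const
    (g := fun p : ℝ × ℝ => p.1 * p.2) (by fun_prop) hU hUmeas
  refine slutsky.congr (fun n => Eventually.of_forall fun ω => ?_)
    (Eventually.of_forall fun ω' => ?_)
  · simp only [div_eq_mul_inv]
  · show √v * Z ω' * (√v)⁻¹ = Z ω'
    rw [mul_comm (√v) (Z ω'), mul_inv_cancel_right₀ hsv]

/-- **The interval `ΔF̂_BAR ± z·√((1/Ĝ − 2)/n)` is asymptotically honest.**  For every `z ≥ 0`, the
probability that `|ΔF̂_n − ΔF| · √n ≤ z · √(1/Ĝ_n − 2)` converges to `gaussianReal 0 1 [−z, z]`. -/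
theorem tendsto_measure_abs_barRoot_sub_le [IsFiniteMeasure ν₀] [IsFiniteMeasure ν₁]
    [IsMarkovKernel κF] [IsMarkovKernel κR] (h0 : ν₀ univ ≠ 0) (h1 : ν₁ univ ≠ 0)
    (h : CrooksPair ν₀ ν₁ κF κR s e W) {ΔF : ℝ}
    (hΔF : Real.exp (-ΔF) = ((ν₀ univ)⁻¹ * ν₁ univ).toReal)
    (hG : ∫ ε, Real.sigmoid (ΔF - W ε) ∂(fwdPathLaw ν₀ κF) < 1 / 2)
    {dhat : ℕ → (ℕ → E × E) → ℝ} (hdm : ∀ n, Measurable (dhat n))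
    (hdhat : ∀ n, 1 ≤ n → ∀ ω, (∑ i ∈ range n, Real.sigmoid (dhat n ω - W (ω i).1)) -
      ∑ i ∈ range n, Real.sigmoid (W (ω i).2 - dhat n ω) = 0) {z : ℝ} (hz : 0 ≤ z) :
    haveI := isProbabilityMeasure_fwdPathLaw ν₀ h0 κF
    haveI := isProbabilityMeasure_fwdPathLaw ν₁ h1 κR
    Tendsto (fun n : ℕ => (Measure.infinitePi fun _ : ℕ => (fwdPathLaw ν₀ κF).prod (fwdPathLaw ν₁ κR))
        {ω | |√(n : ℝ) * (dhat n ω - ΔF) /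
          √(1 / ((∑ i ∈ range n, Real.sigmoid (dhat n ω - W (ω i).1)) / n) - 2)| ≤ z})
      atTop (𝓝 (gaussianReal 0 1 (Icc (-z) z))) := by
  haveI := isProbabilityMeasure_fwdPathLaw ν₀ h0 κF
  haveI := isProbabilityMeasure_fwdPathLaw ν₁ h1 κR
  have hd := h.tendstoInDistribution_barRoot_studentized h0 h1 hΔF hG hdm hdhat
    (P' := gaussianReal 0 1) (Z := id) HasLaw.id
  have hnull : ((gaussianReal 0 1).map id) (frontier (Icc (-z) z)) = 0 := by
    rw [Measure.map_id, frontier_Icc (by linarith : -z ≤ z)]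
    haveI := nullSingletonClass_gaussianReal (μ := 0) (v := 1) one_ne_zero
    exact (Set.toFinite {-z, z}).measure_zero _
  have key := ProbabilityMeasure.tendsto_measure_of_null_frontier_of_tendsto' hd.tendsto
    (E := Icc (-z) z) (by simpa using hnull)
  simp only [ProbabilityMeasure.coe_mk, Measure.map_id] at key
  refine key.congr fun n => ?_
  rw [Measure.map_apply_of_aemeasurable (hd.forall_aemeasurable n) measurableSet_Icc]
  congr 1
  ext ω
  simp only [Set.mem_preimage, Set.mem_Icc, mem_setOf_eq, abs_le]

end CrooksPair

end Summit.Ventures.LatticeQCDFlow.Exactness.GeneralNCMC
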